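import Summits.ValiantsHypothesis.ValiantsHypothesis.Theses.FeketeSOS

/-!
# `FeketeSOS.CharPSparseSOS` (stmt-ValiantsHypothesis-14989) — negative side: load-bearing hypotheses

Standing disprover (cdisprove, cycle 1), from `Cruxes/CharPSparseSOS/Disproof.lean` §(a).
Any proof of the crux — the cyclic, characteristic-`p` sparse-SOS lower bound for the reduced Fekete polynomial — must use
* that the modulus is PRIME: `charPSparseSOS_false_without_prime` — with the Jacobi symbol over all moduli `N`, any prime
  characteristic `ℓ ∣ N` and the cyclic relation mod `X^N − 1`, the statement fails at every large prime square `N = q²`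
  (characteristic `q`), where `∑_{m<N} J(m|N) X^m = (X + ⋯ + X^{q-1})(1 + X^q + ⋯ + X^{q(q-1)})` EXACTLY (degree `< N`) is four
  squares of support-sum `≤ 4q − 2 < 4√N`;
* the VALUES of `χ_p`, not just "±1 on `[1,p-1]`, 0 at 0": `charPSparseSOS_false_without_legendre` — for every prime `p ≥ 5`
  the all-ones pattern `X + ⋯ + X^{p-1}` (in characteristic `p` the socle line `(X−1)^{p−1} − 1`) has in `(ZMod p)[X]` an exact
  4-square representation of degree `< p` and support-sum `≤ 12√p` (digit tiling `p − 1 = ab + r`, `a = ⌊√(p−1)⌋`, `1 ≤ r ≤ a`).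
These are the characteristic-`p`/cyclic ports of `FeketeSOSHard.Negative.feketeSOSHard_false_without_prime/_legendre` (the
identities are characteristic-free; the weights `±1/4` need `p ≥ 5`).  Elementary; no facts: the refuted VARIANTS are inlined in
the two `¬ (…)` statements (inner block = the crux's, verbatim, with the target / modulus replaced); the `def`s are the witness
polynomials. [folklore]
-/

set_option linter.dupNamespace false

namespace Summit.ValiantsHypothesis.ValiantsHypothesis.Theorems.CharPSparseSOS.Negative

open Polynomial Finset

noncomputable section

variable {K : Type} [Field K]

/-- The four polynomials `P+Q, P-Q, M+T, M-T` of the two-products-are-four-squares identity. [folklore] -/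
def sqg (P Q M T : K[X]) : Fin 4 → K[X] := ![P + Q, P - Q, M + T, M - T]

/-- The weights `1/4, -1/4, 1/4, -1/4`. [folklore] -/
def sqc (K : Type) [Field K] : Fin 4 → K := ![1 / 4, -1 / 4, 1 / 4, -1 / 4]

/-- `PQ + MT = ¼(P+Q)² − ¼(P−Q)² + ¼(M+T)² − ¼(M−T)²` whenever `4 ≠ 0` in `K`. -/
theorem sqg_sum (h4 : (4 : K) ≠ 0) (P Q M T : K[X]) :
    (∑ i, C (sqc K i) * sqg P Q M T i ^ 2) = P * Q + M * T := by
  have h4' : C (1 / 4 : K) * 4 = 1 := by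
    rw [show (4 : K[X]) = C 4 from (map_ofNat C 4).symm, ← C_mul, ← C_1]
    congr 1; field_simp
  have hneg : C (-1 / 4 : K) = -C (1 / 4 : K) := by
    rw [← map_neg]; congr 1; ring
  simp only [Fin.sum_univ_four, sqg, sqc, Matrix.cons_val_zero, Matrix.cons_val_one, Matrix.cons_val_two,
    Matrix.cons_val_three, Matrix.head_cons, Matrix.tail_cons, hneg]
  linear_combination (P * Q + M * T) * h4'

/-- `|supp (P+Q)| ≤ |supp P| + |supp Q|`. -/
theorem card_support_add_le (P Q : K[X]) :
    (P + Q).support.card ≤ P.support.card + Q.support.card :=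
  (card_le_card support_add).trans (card_union_le _ _)

/-- `|supp (P−Q)| ≤ |supp P| + |supp Q|`. -/
theorem card_support_sub_le (P Q : K[X]) :
    (P - Q).support.card ≤ P.support.card + Q.support.card := by
  have := card_support_add_le P (-Q); rwa [support_neg, ← sub_eq_add_neg] at this

/-- Support-sum of the four squares is at most twice the supports of the four factors. -/
theorem sqg_support (P Q M T : K[X]) :
    (∑ i, ((sqg P Q M T i).support.card : ℝ)) ≤
      2 * (P.support.card + Q.support.card + M.support.card + T.support.card) := by
  simp only [Fin.sum_univ_four, sqg, Matrix.cons_val_zero, Matrix.cons_val_one, Matrix.cons_val_two,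
    Matrix.cons_val_three, Matrix.head_cons, Matrix.tail_cons]
  have e1 : ((P + Q).support.card : ℝ) ≤ P.support.card + Q.support.card := mod_cast card_support_add_le P Q
  have e2 : ((P - Q).support.card : ℝ) ≤ P.support.card + Q.support.card := mod_cast card_support_sub_le P Q
  have e3 : ((M + T).support.card : ℝ) ≤ M.support.card + T.support.card := mod_cast card_support_add_le M T
  have e4 : ((M - T).support.card : ℝ) ≤ M.support.card + T.support.card := mod_cast card_support_sub_le M T
  linarith

/-- The four squares have degree at most the maximum degree of the four factors. -/
theorem sqg_natDegree (P Q M T : K[X]) (D : ℕ) (hP : P.natDegree ≤ D) (hQ : Q.natDegree ≤ D)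
    (hM : M.natDegree ≤ D) (hT : T.natDegree ≤ D) : ∀ i, (sqg P Q M T i).natDegree ≤ D := by
  intro i
  fin_cases i
  · exact (natDegree_add_le _ _).trans (max_le hP hQ)
  · exact (natDegree_sub_le _ _).trans (max_le hP hQ)
  · exact (natDegree_add_le _ _).trans (max_le hM hT)
  · exact (natDegree_sub_le _ _).trans (max_le hM hT)

/-- Support of a finite sum of polynomials is at most the sum of the supports. -/
theorem card_support_sum_le {ι : Type*} (s : Finset ι) (f : ι → K[X]) :
    (∑ i ∈ s, f i).support.card ≤ ∑ i ∈ s, (f i).support.card := by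
  classical
  induction s using Finset.induction_on with
  | empty => simp
  | @insert a s ha ih =>
    rw [sum_insert ha, sum_insert ha]
    exact (card_support_add_le _ _).trans (by omega)

/-- A monomial `X^n` has at most one term. -/
theorem card_support_X_pow_le (n : ℕ) : ((X : K[X]) ^ n).support.card ≤ 1 := by
  rw [← one_mul (X ^ n), ← C_1]; exact card_support_C_mul_X_pow_le_one

/-- A sum of `|s|` monomials has at most `|s|` terms. -/
theorem card_support_sum_X_pow_le {ι : Type*} (s : Finset ι) (e : ι → ℕ) :
    (∑ i ∈ s, (X : K[X]) ^ e i).support.card ≤ s.card := by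
  refine (card_support_sum_le s _).trans ?_
  calc ∑ i ∈ s, ((X : K[X]) ^ e i).support.card ≤ ∑ _i ∈ s, 1 :=
        sum_le_sum fun i _ => card_support_X_pow_le (e i)
    _ = s.card := by simp

/-- Digit decomposition of `range (a*b)`: `m = k + a j`, `k < a`, `j < b`. -/
theorem sum_range_mul_eq {M : Type*} [AddCommMonoid M] (f : ℕ → M) (a b : ℕ) :
    ∑ m ∈ range (a * b), f m = ∑ j ∈ range b, ∑ k ∈ range a, f (k + a * j) := by
  induction b with
  | zero => simp
  | succ b ih =>
    rw [Nat.mul_succ, sum_range_add, ih, sum_range_succ]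
    congr 1
    exact sum_congr rfl fun k _ => by rw [add_comm]

variable (K)

/-- The cyclotomic-shadow "Fekete polynomial" of an arbitrary modulus `N` read in `K`, with the Jacobi symbol:
`∑_{m<N} J(m|N) X^m`; for prime `N` it is the crux's inlined `F̄_N`. [folklore] -/
def jacobiFekete (N : ℕ) : K[X] := ∑ m ∈ range N, C ((jacobiSym m N : ℤ) : K) * X ^ m

/-- low digits `x + x² + ⋯ + xⁿ`. [folklore] -/
def lowDigits (n : ℕ) : K[X] := ∑ k ∈ range n, X ^ (k + 1)
/-- high digits `∑_{j<b} x^{a j}`. [folklore] -/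
def highDigits (a b : ℕ) : K[X] := ∑ j ∈ range b, X ^ (a * j)

variable {K}

/-- `J(m | q²) = [q ∤ m]` for a prime `q`. -/
theorem jacobiSym_natCast_prime_sq (q : ℕ) [Fact q.Prime] (m : ℕ) :
    jacobiSym (m : ℤ) (q ^ 2) = if q ∣ m then 0 else 1 := by
  have : NeZero q := ⟨(Fact.out : q.Prime).ne_zero⟩
  rw [sq, jacobiSym.mul_right, ← jacobiSym.legendreSym.to_jacobiSym]
  by_cases h : q ∣ m
  · have h0 : ((m : ℤ) : ZMod q) = 0 := by rw [Int.cast_natCast, ZMod.natCast_eq_zero_iff]; exact h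
    rw [if_pos h, (legendreSym.eq_zero_iff q (m : ℤ)).mpr h0, zero_mul]
  · have h0 : ((m : ℤ) : ZMod q) ≠ 0 := by rw [Int.cast_natCast, Ne, ZMod.natCast_eq_zero_iff]; exact h
    rw [if_neg h, ← sq, legendreSym.sq_one q h0]

/-- `x + ⋯ + xⁿ` has at most `n` terms. -/
theorem card_support_lowDigits (n : ℕ) : (lowDigits K n).support.card ≤ n := by
  unfold lowDigits; simpa using card_support_sum_X_pow_le (K := K) (range n) (fun k => k + 1)

/-- `∑_{j<b} x^{aj}` has at most `b` terms. -/
theorem card_support_highDigits (a b : ℕ) : (highDigits K a b).support.card ≤ b := by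
  unfold highDigits; simpa using card_support_sum_X_pow_le (K := K) (range b) (fun j => a * j)

/-- `deg (x + ⋯ + xⁿ) ≤ n`. -/
theorem natDegree_lowDigits (n : ℕ) : (lowDigits K n).natDegree ≤ n :=
  natDegree_sum_le_of_forall_le _ _ fun k hk => (natDegree_X_pow_le _).trans (by
    have := mem_range.mp hk; omega)

/-- `deg ∑_{j<b} x^{aj} ≤ a (b - 1)`. -/
theorem natDegree_highDigits (a b : ℕ) : (highDigits K a b).natDegree ≤ a * (b - 1) :=
  natDegree_sum_le_of_forall_le _ _ fun j hj => (natDegree_X_pow_le _).trans (by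
    have := mem_range.mp hj; exact Nat.mul_le_mul_left a (by omega))

/-- The digit factorisation at a prime square, read in `K`:
`∑_{m<q²} J(m|q²) x^m = (x + ⋯ + x^{q-1}) · (1 + x^q + ⋯ + x^{q(q-1)})`. -/
theorem jacobiFekete_prime_sq (n : ℕ) [Fact (n + 1).Prime] :
    jacobiFekete K ((n + 1) ^ 2) = lowDigits K n * highDigits K (n + 1) (n + 1) := by
  unfold jacobiFekete lowDigits highDigits
  rw [sum_mul_sum, sq, sum_range_mul_eq, sum_comm, sum_range_succ']
  have h0 : ∑ j ∈ range (n + 1), C ((jacobiSym ((0 + (n + 1) * j : ℕ) : ℤ) ((n + 1) * (n + 1)) : ℤ) : K) *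
      X ^ (0 + (n + 1) * j) = 0 := by
    refine sum_eq_zero fun j _ => ?_
    rw [← sq, jacobiSym_natCast_prime_sq (n + 1), if_pos ⟨j, by ring⟩]; simp
  rw [h0, add_zero]
  refine sum_congr rfl fun k hk => sum_congr rfl fun j _ => ?_
  have hk' : k < n := mem_range.mp hk
  have hnd : ¬ (n + 1) ∣ (k + 1) + (n + 1) * j := by
    rw [Nat.dvd_add_left ⟨j, rfl⟩]; exact Nat.not_dvd_of_pos_of_lt (Nat.succ_pos k) (by omega)
  rw [← sq, jacobiSym_natCast_prime_sq (n + 1) ((k + 1) + (n + 1) * j), if_neg hnd]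
  simp [pow_add]

/-- Digit tiling of `x + ⋯ + x^{ab+r}`:
`= (x + ⋯ + x^a)(∑_{j<b} x^{aj}) + x^{ab+1}(1 + ⋯ + x^{r-1})`. -/
theorem ones_digit_identity (a b r : ℕ) :
    (∑ m ∈ range (a * b + r), (X : K[X]) ^ (m + 1)) =
      lowDigits K a * highDigits K a b + X ^ (a * b + 1) * ∑ k ∈ range r, X ^ k := by
  unfold lowDigits highDigits
  rw [sum_range_add, sum_mul_sum, sum_range_mul_eq, mul_sum]
  refine congrArg₂ (· + ·) ?_ ?_
  · rw [sum_comm]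
    refine sum_congr rfl fun k _ => sum_congr rfl fun j _ => ?_
    rw [← pow_add, show k + a * j + 1 = (k + 1) + a * j by ring]
  · refine sum_congr rfl fun k _ => ?_
    rw [← pow_add, show a * b + k + 1 = (a * b + 1) + k by ring]

/-- The all-ones pattern `ε m = [m ≠ 0]`. [folklore] -/
def onesPattern : ℕ → ℤ := fun m => if m = 0 then 0 else 1

/-- The all-ones pattern renders as `x + x² + ⋯ + x^N`. -/
theorem ones_poly_eq (N : ℕ) :
    (∑ m ∈ range (N + 1), C ((onesPattern m : ℤ) : K) * X ^ m) = ∑ m ∈ range N, (X : K[X]) ^ (m + 1) := by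
  rw [sum_range_succ']
  simp [onesPattern]

/-! ## (a) Load-bearing hypotheses -/

section LoadBearing

open Polynomial Finset

/-- `(4 : ZMod q) ≠ 0` for a prime `q ≥ 5`. -/
theorem four_ne_zero_zmod (q : ℕ) [Fact q.Prime] (hq : 5 ≤ q) : (4 : ZMod q) ≠ 0 := by
  intro h
  have h' : ((4 : ℕ) : ZMod q) = 0 := by exact_mod_cast h
  rw [ZMod.natCast_eq_zero_iff] at h'
  have := Nat.le_of_dvd (by norm_num) h'
  omega

/-- **Primality is load-bearing (cyclic, positive characteristic).**  The all-moduli variant of the crux —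
modulus `N`, Jacobi symbol, any prime characteristic `ℓ ∣ N`, cyclic mod `X^N − 1` — is false: at `N = q²`
(`q` prime), in characteristic `q`, `∑_{m<N} J(m|N) X^m = (X + ⋯ + X^{q-1})(1 + X^q + ⋯ + X^{q(q-1)})` EXACTLY
(degree `< N`, no folding needed), a 4-square representation of support-sum `≤ 4q − 2 < 4√N`.  So for every
`δ > 0` the bound `N^{1/2+δ}` fails as soon as `q^{2δ} ≥ 4`.  (Port of the parent's
`FeketeSOSHard.Negative.feketeSOSHard_false_without_prime` from `ℂ` to `ZMod q`; the identity is
characteristic-free.) [folklore; digit tiling] -/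
theorem charPSparseSOS_false_without_prime :
    ¬ (∃ δ : ℝ, 0 < δ ∧ ∃ N₀ : ℕ, ∀ N : ℕ, N₀ ≤ N → ∀ (ℓ : ℕ) [Fact ℓ.Prime], ℓ ∣ N →
        ∀ (K : Type) [Field K] [CharP K ℓ] (s : ℕ) (c : Fin s → K) (g : Fin s → K[X]),
          (s : ℝ) ≤ (N : ℝ) ^ δ → (∀ i, (g i).natDegree < N) →
          ((X : K[X]) ^ N - 1 ∣
              (∑ i, C (c i) * g i ^ 2) - ∑ m ∈ range N, C ((jacobiSym m N : ℤ) : K) * X ^ m) →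
          (N : ℝ) ^ (1 / 2 + δ) ≤ ∑ i, ((g i).support.card : ℝ)) := by
  rintro ⟨δ, hδ, N₀, h⟩
  obtain ⟨q, hq, hqprime⟩ := Nat.exists_infinite_primes (max (max N₀ (⌈(4 : ℝ) ^ (1 / δ)⌉₊ + 1)) 5)
  haveI : Fact q.Prime := ⟨hqprime⟩
  have hq5 : 5 ≤ q := le_of_max_le_right hq
  have h4 : (4 : ZMod q) ≠ 0 := four_ne_zero_zmod q hq5
  obtain ⟨n, rfl⟩ : ∃ n, q = n + 1 := ⟨q - 1, (Nat.succ_pred_eq_of_pos hqprime.pos).symm⟩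
  have hN₀ : N₀ ≤ (n + 1) ^ 2 :=
    le_trans (le_of_max_le_left (le_of_max_le_left hq)) (Nat.le_self_pow two_ne_zero _)
  have key := h ((n + 1) ^ 2) hN₀ (n + 1) (dvd_pow_self _ two_ne_zero) (ZMod (n + 1)) 4 (sqc (ZMod (n + 1)))
    (sqg (lowDigits (ZMod (n + 1)) n) (highDigits (ZMod (n + 1)) (n + 1) (n + 1)) 0 0)
  have hq1 : (1 : ℝ) ≤ ((n + 1 : ℕ) : ℝ) := by exact_mod_cast Nat.succ_le_succ (Nat.zero_le n)
  have hq0 : (0 : ℝ) ≤ ((n + 1 : ℕ) : ℝ) := le_trans zero_le_one hq1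
  have hceil : (4 : ℝ) ^ (1 / δ) ≤ ((n + 1 : ℕ) : ℝ) := by
    have h1 : (⌈(4 : ℝ) ^ (1 / δ)⌉₊ : ℝ) ≤ ((n + 1 : ℕ) : ℝ) :=
      mod_cast le_trans (Nat.le_succ _) (le_of_max_le_right (le_of_max_le_left hq))
    exact le_trans (Nat.le_ceil _) h1
  have hcast : (((n + 1) ^ 2 : ℕ) : ℝ) = ((n + 1 : ℕ) : ℝ) ^ (2 : ℕ) := by push_cast; ring
  have hqδ : (4 : ℝ) ≤ ((n + 1 : ℕ) : ℝ) ^ δ := by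
    have : ((4 : ℝ) ^ (1 / δ)) ^ δ ≤ ((n + 1 : ℕ) : ℝ) ^ δ :=
      Real.rpow_le_rpow (by positivity) hceil hδ.le
    rwa [← Real.rpow_mul (by norm_num), one_div_mul_cancel hδ.ne', Real.rpow_one] at this
  have hNδ : (4 : ℝ) ≤ (((n + 1) ^ 2 : ℕ) : ℝ) ^ δ := by
    refine le_trans hqδ (Real.rpow_le_rpow hq0 ?_ hδ.le)
    rw [hcast]; exact le_self_pow₀ hq1 two_ne_zero
  have hsplit : (((n + 1) ^ 2 : ℕ) : ℝ) ^ (1 / 2 + δ) =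
      ((n + 1 : ℕ) : ℝ) * (((n + 1) ^ 2 : ℕ) : ℝ) ^ δ := by
    rw [Real.rpow_add (by positivity), hcast, ← Real.rpow_natCast_mul hq0]
    norm_num
  have hs : ((4 : ℕ) : ℝ) ≤ (((n + 1) ^ 2 : ℕ) : ℝ) ^ δ := by exact_mod_cast hNδ
  have hlt1 : n < (n + 1) ^ 2 := by nlinarith
  have hlt2 : (n + 1) * (n + 1 - 1) < (n + 1) ^ 2 := by
    rw [Nat.add_sub_cancel, sq]; exact Nat.mul_lt_mul_of_pos_left (Nat.lt_succ_self n) (Nat.succ_pos n)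
  have hdeg : ∀ i, (sqg (lowDigits (ZMod (n + 1)) n) (highDigits (ZMod (n + 1)) (n + 1) (n + 1)) 0 0 i).natDegree
      < (n + 1) ^ 2 := by
    have hle := sqg_natDegree (lowDigits (ZMod (n + 1)) n) (highDigits (ZMod (n + 1)) (n + 1) (n + 1)) 0 0
      ((n + 1) ^ 2 - 1) ((natDegree_lowDigits n).trans (by omega))
      ((natDegree_highDigits _ _).trans (by omega)) (by simp) (by simp)
    intro i; have := hle i; have h2 : 1 ≤ (n + 1) ^ 2 := Nat.one_le_pow _ _ (Nat.succ_pos n); omega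
  have hid : (∑ i, C (sqc (ZMod (n + 1)) i) *
      sqg (lowDigits (ZMod (n + 1)) n) (highDigits (ZMod (n + 1)) (n + 1) (n + 1)) 0 0 i ^ 2) =
      jacobiFekete (ZMod (n + 1)) ((n + 1) ^ 2) := by
    rw [sqg_sum h4, jacobiFekete_prime_sq, zero_mul, add_zero]
  have hdvd : ((X : (ZMod (n + 1))[X]) ^ ((n + 1) ^ 2) - 1 ∣
      (∑ i, C (sqc (ZMod (n + 1)) i) *
        sqg (lowDigits (ZMod (n + 1)) n) (highDigits (ZMod (n + 1)) (n + 1) (n + 1)) 0 0 i ^ 2) -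
      ∑ m ∈ range ((n + 1) ^ 2), C ((jacobiSym m ((n + 1) ^ 2) : ℤ) : ZMod (n + 1)) * X ^ m) := by
    rw [hid]; unfold jacobiFekete; rw [sub_self]; exact dvd_zero _
  have hbound := key hs hdeg hdvd
  have hsupp := sqg_support (lowDigits (ZMod (n + 1)) n) (highDigits (ZMod (n + 1)) (n + 1) (n + 1)) 0 0
  have hl : ((lowDigits (ZMod (n + 1)) n).support.card : ℝ) ≤ n := mod_cast card_support_lowDigits n
  have hh : ((highDigits (ZMod (n + 1)) (n + 1) (n + 1)).support.card : ℝ) ≤ (n + 1 : ℕ) :=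
    mod_cast card_support_highDigits (n + 1) (n + 1)
  have hz : ((0 : (ZMod (n + 1))[X]).support.card : ℝ) = 0 := by simp
  rw [hz] at hsupp; rw [hsplit] at hbound
  have hq' : ((n + 1 : ℕ) : ℝ) = n + 1 := by push_cast; ring
  rw [hq'] at hbound hqδ hh
  have h4q : 4 * ((n : ℝ) + 1) ≤ ((n : ℝ) + 1) * (((n + 1) ^ 2 : ℕ) : ℝ) ^ δ := by nlinarith
  linarith

/-- **The values of `χ_p` are load-bearing (cyclic, characteristic `p`).**  For EVERY prime `p ≥ 5` the all-ones
pattern `X + X² + ⋯ + X^{p-1}` (a legal sign pattern: support `[1,p-1]`, coefficients `±1`) has, in `(ZMod p)[X]`,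
the EXACT 4-square representation `sqg (lowDigits a) (highDigits a b) (X^{ab+1}) (1 + ⋯ + X^{r-1})` with
`a = ⌊√(p-1)⌋`, `p - 1 = ab + r`, `1 ≤ r ≤ a`, of degree `< p` and support-sum `≤ 2(a + b + 1 + r) ≤ 12√p
< p^{1/2+δ}` once `p^δ ≥ 13`.  So the all-sign-patterns variant of the crux is false in the cyclic characteristic-`p`
model too: the exponent must come from the values of `χ_p` (Euler's criterion), not from covering `[1,p-1]` by few
sumsets.  In characteristic `p` the target is `(X−1)^{p−1} − 1`, i.e. `z^{p−1} − 1` in `k[z]/(z^p)`: the socle line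
is cheap, the middle monomial `z^{(p−1)/2}` is the claim.  (Port of the parent's
`FeketeSOSHard.Negative.feketeSOSHard_false_without_legendre`.) [folklore] -/
theorem charPSparseSOS_false_without_legendre :
    ¬ (∃ δ : ℝ, 0 < δ ∧ ∃ p₀ : ℕ, ∀ (p : ℕ) [Fact p.Prime], p₀ ≤ p → ∀ ε : ℕ → ℤ, ε 0 = 0 →
        (∀ m, 0 < m → m < p → (ε m = 1 ∨ ε m = -1)) →
        ∀ (K : Type) [Field K] [CharP K p] (s : ℕ) (c : Fin s → K) (g : Fin s → K[X]),
          (s : ℝ) ≤ (p : ℝ) ^ δ → (∀ i, (g i).natDegree < p) →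
          ((X : K[X]) ^ p - 1 ∣ (∑ i, C (c i) * g i ^ 2) - ∑ m ∈ range p, C ((ε m : ℤ) : K) * X ^ m) →
          (p : ℝ) ^ (1 / 2 + δ) ≤ ∑ i, ((g i).support.card : ℝ)) := by
  rintro ⟨δ, hδ, p₀, h⟩
  obtain ⟨p, hp, hpprime⟩ := Nat.exists_infinite_primes (max (max p₀ (⌈(13 : ℝ) ^ (1 / δ)⌉₊ + 2)) 5)
  haveI : Fact p.Prime := ⟨hpprime⟩
  have hp5 : 5 ≤ p := le_of_max_le_right hp
  have h4 : (4 : ZMod p) ≠ 0 := four_ne_zero_zmod p hp5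
  obtain ⟨N, rfl⟩ : ∃ N, p = N + 1 := ⟨p - 1, (Nat.succ_pred_eq_of_pos hpprime.pos).symm⟩
  -- digits of N = p - 1 : N = a * b + r, a = ⌊√N⌋, 1 ≤ r ≤ a
  set a := Nat.sqrt N with ha
  set b := (N - 1) / a with hb
  set r := N - a * b with hr
  have hN4 : 4 ≤ N := by omega
  have ha1 : 1 ≤ a := by rw [ha]; exact Nat.le_sqrt.mpr (by nlinarith)
  have hdm : N - 1 = a * b + (N - 1) % a := by rw [hb]; exact (Nat.div_add_mod (N - 1) a).symm
  have hmod : (N - 1) % a < a := Nat.mod_lt _ ha1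
  have hNabr : N = a * b + r := by omega
  have hr1 : 1 ≤ r := by omega
  have hra : r ≤ a := by omega
  have haa : a * a ≤ N := by rw [ha]; exact Nat.sqrt_le N
  have hNlt : N < (a + 1) * (a + 1) := by rw [ha]; exact Nat.lt_succ_sqrt N
  have hb_le : b ≤ a + 2 := by
    rw [hb]
    have : N - 1 ≤ a * (a + 2) := by
      have : N ≤ a * (a + 2) := by nlinarith
      omega
    calc (N - 1) / a ≤ (a * (a + 2)) / a := Nat.div_le_div_right this
      _ = a + 2 := Nat.mul_div_cancel_left _ ha1
  have haN : a ≤ N := (Nat.le_mul_self a).trans haa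
  -- the witness
  set T : (ZMod (N + 1))[X] := ∑ k ∈ range r, X ^ k with hT
  set M : (ZMod (N + 1))[X] := X ^ (a * b + 1) with hM
  have key := h (N + 1) (le_trans (le_of_max_le_left (le_of_max_le_left hp)) le_rfl) onesPattern rfl
    (fun m hm _ => by simp [onesPattern, hm.ne']) (ZMod (N + 1)) 4 (sqc (ZMod (N + 1)))
    (sqg (lowDigits (ZMod (N + 1)) a) (highDigits (ZMod (N + 1)) a b) M T)
  -- reals
  have hp1 : (1 : ℝ) ≤ ((N + 1 : ℕ) : ℝ) := by exact_mod_cast Nat.succ_le_succ (Nat.zero_le N)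
  have hp0 : (0 : ℝ) < ((N + 1 : ℕ) : ℝ) := lt_of_lt_of_le zero_lt_one hp1
  have hceil : (13 : ℝ) ^ (1 / δ) ≤ ((N + 1 : ℕ) : ℝ) := by
    have h1 : (⌈(13 : ℝ) ^ (1 / δ)⌉₊ : ℝ) ≤ ((N + 1 : ℕ) : ℝ) := by
      have : ⌈(13 : ℝ) ^ (1 / δ)⌉₊ ≤ N + 1 :=
        le_trans (by omega) (le_of_max_le_right (le_of_max_le_left hp))
      exact_mod_cast this
    exact le_trans (Nat.le_ceil _) h1
  have hpδ : (13 : ℝ) ≤ ((N + 1 : ℕ) : ℝ) ^ δ := by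
    have : ((13 : ℝ) ^ (1 / δ)) ^ δ ≤ ((N + 1 : ℕ) : ℝ) ^ δ :=
      Real.rpow_le_rpow (by positivity) hceil hδ.le
    rwa [← Real.rpow_mul (by norm_num), one_div_mul_cancel hδ.ne', Real.rpow_one] at this
  have hs : ((4 : ℕ) : ℝ) ≤ ((N + 1 : ℕ) : ℝ) ^ δ := le_trans (by norm_num) hpδ
  have hsplit : ((N + 1 : ℕ) : ℝ) ^ (1 / 2 + δ) = Real.sqrt ((N + 1 : ℕ) : ℝ) * ((N + 1 : ℕ) : ℝ) ^ δ := by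
    rw [Real.rpow_add hp0, ← Real.sqrt_eq_rpow]
  -- degrees (< p = N + 1)
  have hdeg : ∀ i, (sqg (lowDigits (ZMod (N + 1)) a) (highDigits (ZMod (N + 1)) a b) M T i).natDegree < N + 1 := by
    have hle := sqg_natDegree (lowDigits (ZMod (N + 1)) a) (highDigits (ZMod (N + 1)) a b) M T N
      ((natDegree_lowDigits a).trans haN)
      ((natDegree_highDigits a b).trans (le_trans (Nat.mul_le_mul_left a (Nat.sub_le b 1)) (by omega)))
      (by rw [hM]; exact (natDegree_X_pow_le _).trans (by omega))
      (by
        rw [hT]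
        exact natDegree_sum_le_of_forall_le _ _ fun k hk => (natDegree_X_pow_le _).trans (by
          have := mem_range.mp hk; omega))
    intro i; exact Nat.lt_succ_of_le (hle i)
  -- the identity (exact, hence cyclic)
  have hid : (∑ i, C (sqc (ZMod (N + 1)) i) * sqg (lowDigits (ZMod (N + 1)) a) (highDigits (ZMod (N + 1)) a b) M T i ^ 2) =
      ∑ m ∈ range (N + 1), C ((onesPattern m : ℤ) : ZMod (N + 1)) * X ^ m := by
    rw [sqg_sum h4, ones_poly_eq, hM, hT, ← ones_digit_identity a b r, ← hNabr]
  have hdvd : ((X : (ZMod (N + 1))[X]) ^ (N + 1) - 1 ∣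
      (∑ i, C (sqc (ZMod (N + 1)) i) *
          sqg (lowDigits (ZMod (N + 1)) a) (highDigits (ZMod (N + 1)) a b) M T i ^ 2) -
        ∑ m ∈ range (N + 1), C ((onesPattern m : ℤ) : ZMod (N + 1)) * X ^ m) := by
    rw [hid, sub_self]; exact dvd_zero _
  have hbound := key hs hdeg hdvd
  -- support-sum bookkeeping
  have hsupp := sqg_support (lowDigits (ZMod (N + 1)) a) (highDigits (ZMod (N + 1)) a b) M T
  have hl : ((lowDigits (ZMod (N + 1)) a).support.card : ℝ) ≤ a := by exact_mod_cast card_support_lowDigits a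
  have hh : ((highDigits (ZMod (N + 1)) a b).support.card : ℝ) ≤ b := mod_cast card_support_highDigits a b
  have hMc : (M.support.card : ℝ) ≤ 1 := by rw [hM]; exact_mod_cast card_support_X_pow_le _
  have hTc : (T.support.card : ℝ) ≤ r := by
    have : T.support.card ≤ r := by rw [hT]; exact (card_support_sum_X_pow_le (range r) id).trans (by simp)
    exact_mod_cast this
  have hb' : (b : ℝ) ≤ a + 2 := mod_cast hb_le
  have hr' : (r : ℝ) ≤ a := mod_cast hra
  have hsqrt : (a : ℝ) ≤ Real.sqrt ((N + 1 : ℕ) : ℝ) := by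
    rw [← Real.sqrt_sq (Nat.cast_nonneg a)]
    apply Real.sqrt_le_sqrt
    have : ((a * a : ℕ) : ℝ) ≤ ((N + 1 : ℕ) : ℝ) := by exact_mod_cast haa.trans (Nat.le_succ N)
    push_cast at this ⊢; nlinarith
  have hsqrt1 : (1 : ℝ) ≤ Real.sqrt ((N + 1 : ℕ) : ℝ) := by rw [← Real.sqrt_one]; exact Real.sqrt_le_sqrt hp1
  rw [hsplit] at hbound
  set S := ∑ i, ((sqg (lowDigits (ZMod (N + 1)) a) (highDigits (ZMod (N + 1)) a b) M T i).support.card : ℝ)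
  set sq := Real.sqrt ((N + 1 : ℕ) : ℝ)
  set pδ := ((N + 1 : ℕ) : ℝ) ^ δ
  have h1 : S ≤ 12 * sq := by nlinarith
  have h2 : 13 * sq ≤ sq * pδ := by nlinarith
  have h3 : 0 < sq := lt_of_lt_of_le zero_lt_one hsqrt1
  linarith

end LoadBearing

end

end Summit.ValiantsHypothesis.ValiantsHypothesis.Theorems.CharPSparseSOS.Negative
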